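import Mathlib
import HarnessLib

/-!
# Continuation of a simple lowest eigenvalue along a continuous eigenvalue curve

Family `hubbard` (trunk T-QLATTICE). A finite-dimensional spectral lemma used by Lieb and Wu to
identify the Bethe-ansatz state with the ground state (Physica A 321 (2003) 1, §2, the paragraph
following items 1.–2.: "Suppose that we know the ground state for some particular value of `U`
... and suppose we have a `U`-dependent solution ... with an energy `E(U)` such that (a) `E` is
the known ground state energy [there] and (b) `E(U)` is continuous on the interval. Then `E(U)` is
necessarily the ground state energy in that interval. If not, the curve `E(U)` would have to cross
the ground state curve (which is always continuous), at which point there would be a degeneracy –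
which is impossible according to 1."), made precise and PROVED:

* `Literature.MathematicalPhysics.QuantumLattice.eigenvalue_eq_sectorMin_of_continuousOn`: let `u ↦ A u` be Hermitian matrices
  preserving a subspace `K`, with quadratic forms on `K` Lipschitz in `u`
  (`|Re⟨v, A u v⟩ - Re⟨v, A u' v⟩| ≤ d |u - u'| ‖v‖²`); let `m u` be the lowest energy of `A u` on
  `K` (a lower bound of the Rayleigh quotient on `K` attained at an eigenvector in `K`) and assume
  the ground state of `A u` in `K` is unique up to scalars for every `u` in a preconnected set
  `S ⊆ ℝ`. If `E` is continuous on `S`, `E u` is an eigenvalue of `A u` on a nonzero vector of `K`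
  for every `u ∈ S`, and `E u₀ = m u₀` for some `u₀ ∈ S`, then `E = m` on `S`.

Proof: `m` is `d`-Lipschitz on `S` (variational principle); the coincidence set
`Z = {u ∈ S | E u = m u}` is relatively closed; it is relatively open because at `u⋆ ∈ Z`
simplicity gives a gap `g > 0` of `A u⋆` above `m u⋆` on `K ∩ ψ₀^⊥` (`ψ₀` the ground state;
compactness of the unit sphere of `K ∩ ψ₀^⊥` and the variational principle on that invariant
subspace, `mulVec_eq_smul_of_forall_le_on`), and for `u` near `u⋆` with `E u ≠ m u` the span of
the two orthogonal eigenvectors (ground state of `A u` and the `E u`-eigenvector) contains a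
nonzero vector of `K ∩ ψ₀^⊥` whose energy is both `≤ max (m u, E u) ‖·‖² < (m u⋆ + g/4) ‖·‖²` and
`≥ (m u⋆ + g - g/4) ‖·‖²`; preconnectedness of `S` concludes. No Perron–Frobenius or Bethe
ansatz is involved; the Hubbard-ring instance is in `HubbardRingGroundStateContinuityProofs`.

## Design notes

Pure linear algebra on `ι → ℂ` with Mathlib's `dotProduct`/`mulVec` (the conventions of the
`QuantumLattice` files: `⟨v, w⟩ = star v ⬝ᵥ w`, energies `Re ⟨v, A v⟩`); no `def`s. Mathlib has
the spectral theorem for Hermitian matrices but no eigenvalue-perturbation/continuation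
statements of this kind.

## Sources

* E. H. Lieb, F. Y. Wu, *The one-dimensional Hubbard model: a reminiscence*, Physica A 321
  (2003) 1–27 = arXiv:cond-mat/0207529 (held; key `LiebWuPhysicaA2003`), §2, paragraph after
  items 1.–2.
-/

open Finset Matrix Metric Set Filter Topology
open scoped ComplexOrder

namespace Literature.MathematicalPhysics.QuantumLattice

namespace EigenvalueContinuation

variable {ι : Type*} [Fintype ι]

/-! ### Elementary facts on `⟨v, w⟩ = star v ⬝ᵥ w` -/

/-- `Re ⟨v, v⟩ = Σ |vᵢ|²` is the squared `ℓ²` norm. [folklore] -/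
theorem re_star_dotProduct_self (v : ι → ℂ) : (star v ⬝ᵥ v).re = ∑ i, ‖v i‖ ^ 2 := by
  simp only [dotProduct, Pi.star_apply, Complex.re_sum]
  refine Finset.sum_congr rfl fun i _ => ?_
  rw [Complex.star_def, ← Complex.normSq_eq_conj_mul_self, Complex.normSq_eq_norm_sq]
  norm_cast

/-- `⟨v, v⟩` is real. [folklore] -/
theorem im_star_dotProduct_self (v : ι → ℂ) : (star v ⬝ᵥ v).im = 0 :=
  (Complex.nonneg_iff.1 (dotProduct_star_self_nonneg v)).2.symm

/-- `Re ⟨v, v⟩ ≥ 0`. [folklore] -/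
theorem re_star_dotProduct_self_nonneg (v : ι → ℂ) : 0 ≤ (star v ⬝ᵥ v).re := by
  rw [re_star_dotProduct_self]
  positivity

/-- `Re ⟨v, v⟩ > 0` for `v ≠ 0`. [folklore] -/
theorem re_star_dotProduct_self_pos {v : ι → ℂ} (hv : v ≠ 0) : 0 < (star v ⬝ᵥ v).re := by
  have h : star v ⬝ᵥ v ≠ 0 := fun h => hv (dotProduct_star_self_eq_zero.1 h)
  rcases (re_star_dotProduct_self_nonneg v).lt_or_eq with h1 | h1
  · exact h1
  · exact absurd (Complex.ext (by simpa using h1.symm) (by simpa using im_star_dotProduct_self v)) h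

/-- Each coordinate is bounded by the `ℓ²` norm: `|vᵢ|² ≤ Re ⟨v, v⟩`. [folklore] -/
theorem norm_apply_sq_le (v : ι → ℂ) (i : ι) : ‖v i‖ ^ 2 ≤ (star v ⬝ᵥ v).re := by
  rw [re_star_dotProduct_self]
  exact Finset.single_le_sum (f := fun j => ‖v j‖ ^ 2) (fun j _ => by positivity) (mem_univ i)

/-- Real scalings of a pairing: `⟨c v, c w⟩ = c² ⟨v, w⟩`. [folklore] -/
theorem star_real_smul_dotProduct_real_smul (c : ℝ) (v w : ι → ℂ) :
    star ((c : ℂ) • v) ⬝ᵥ ((c : ℂ) • w) = ((c * c : ℝ) : ℂ) * (star v ⬝ᵥ w) := by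
  rw [star_smul, smul_dotProduct, dotProduct_smul, smul_smul, Complex.star_def,
    Complex.conj_ofReal, smul_eq_mul]
  push_cast
  ring

/-- Every nonzero vector has a positive real multiple of unit `ℓ²` norm. [folklore] -/
theorem exists_normalize {w : ι → ℂ} (hw : w ≠ 0) :
    ∃ c : ℝ, 0 < c ∧ c * c * (star w ⬝ᵥ w).re = 1 ∧ star ((c : ℂ) • w) ⬝ᵥ ((c : ℂ) • w) = 1 := by
  have hpos := re_star_dotProduct_self_pos hw
  set n : ℝ := (star w ⬝ᵥ w).re with hn
  have hnc : star w ⬝ᵥ w = (n : ℂ) := Complex.ext (by simp [hn]) (by simp [im_star_dotProduct_self])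
  refine ⟨(Real.sqrt n)⁻¹, inv_pos.2 (Real.sqrt_pos.2 hpos), ?_, ?_⟩
  · rw [← mul_inv, Real.mul_self_sqrt hpos.le, inv_mul_cancel₀ hpos.ne']
  · rw [star_real_smul_dotProduct_real_smul, hnc, ← Complex.ofReal_mul, ← mul_inv,
      Real.mul_self_sqrt hpos.le, inv_mul_cancel₀ hpos.ne', Complex.ofReal_one]

/-- For a Hermitian matrix, `⟨v, A w⟩ = conj ⟨w, A v⟩`. [folklore] -/
theorem star_dotProduct_mulVec_comm {A : Matrix ι ι ℂ} (hA : Aᴴ = A) (v w : ι → ℂ) :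
    star v ⬝ᵥ A *ᵥ w = star (star w ⬝ᵥ A *ᵥ v) := by
  conv_rhs => rw [← star_dotProduct_star, star_star, star_mulVec, ← dotProduct_mulVec, hA]

/-- Eigenvectors of a Hermitian matrix for distinct real eigenvalues are orthogonal. [folklore] -/
theorem star_dotProduct_eq_zero_of_eigen {A : Matrix ι ι ℂ} (hA : Aᴴ = A) {a b : ℝ} (hab : a ≠ b)
    {ψ φ : ι → ℂ} (hψ : A *ᵥ ψ = (a : ℂ) • ψ) (hφ : A *ᵥ φ = (b : ℂ) • φ) : star ψ ⬝ᵥ φ = 0 := by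
  have h1 : star ψ ⬝ᵥ A *ᵥ φ = (b : ℂ) * (star ψ ⬝ᵥ φ) := by rw [hφ, dotProduct_smul, smul_eq_mul]
  have h2 : star ψ ⬝ᵥ A *ᵥ φ = (a : ℂ) * (star ψ ⬝ᵥ φ) := by
    rw [star_dotProduct_mulVec_comm hA, hψ, dotProduct_smul, smul_eq_mul, star_mul',
      Complex.star_def, Complex.conj_ofReal, ← Complex.star_def, star_dotProduct, star_star]
  have h3 : ((a : ℂ) - b) * (star ψ ⬝ᵥ φ) = 0 := by rw [sub_mul, ← h1, ← h2, sub_self]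
  rcases mul_eq_zero.1 h3 with h | h
  · exact absurd (by exact_mod_cast sub_eq_zero.1 h) hab
  · exact h

/-- The energy of an eigenvector: `Re ⟨ψ, A ψ⟩ = E ‖ψ‖²` if `A ψ = E ψ`. [folklore] -/
theorem re_star_dotProduct_mulVec_of_eigen {A : Matrix ι ι ℂ} {E : ℝ} {ψ : ι → ℂ}
    (hψ : A *ᵥ ψ = (E : ℂ) • ψ) : (star ψ ⬝ᵥ A *ᵥ ψ).re = E * (star ψ ⬝ᵥ ψ).re := by
  rw [hψ, dotProduct_smul, smul_eq_mul, Complex.re_ofReal_mul]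

/-- The energy of a combination of two orthogonal eigenvectors:
`Re ⟨αψ + βφ, A (αψ + βφ)⟩ = a |α|² ‖ψ‖² + b |β|² ‖φ‖²` and `‖αψ + βφ‖² = |α|² ‖ψ‖² + |β|² ‖φ‖²`.
[folklore] -/
theorem energy_pair {A : Matrix ι ι ℂ} {a b : ℝ} {ψ φ : ι → ℂ}
    (hψ : A *ᵥ ψ = (a : ℂ) • ψ) (hφ : A *ᵥ φ = (b : ℂ) • φ) (horth : star ψ ⬝ᵥ φ = 0) (α β : ℂ) :
    (star (α • ψ + β • φ) ⬝ᵥ A *ᵥ (α • ψ + β • φ)).re =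
        a * (‖α‖ ^ 2 * (star ψ ⬝ᵥ ψ).re) + b * (‖β‖ ^ 2 * (star φ ⬝ᵥ φ).re) ∧
      (star (α • ψ + β • φ) ⬝ᵥ (α • ψ + β • φ)).re =
        ‖α‖ ^ 2 * (star ψ ⬝ᵥ ψ).re + ‖β‖ ^ 2 * (star φ ⬝ᵥ φ).re := by
  have horth' : star φ ⬝ᵥ ψ = 0 := by
    rw [star_dotProduct, horth, star_zero]
  have hψψ : star ψ ⬝ᵥ ψ = ((star ψ ⬝ᵥ ψ).re : ℂ) :=
    Complex.ext (by simp) (by simp [im_star_dotProduct_self])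
  have hφφ : star φ ⬝ᵥ φ = ((star φ ⬝ᵥ φ).re : ℂ) :=
    Complex.ext (by simp) (by simp [im_star_dotProduct_self])
  have hαα : star α * α = ((‖α‖ ^ 2 : ℝ) : ℂ) := by
    rw [Complex.star_def, ← Complex.normSq_eq_conj_mul_self, Complex.normSq_eq_norm_sq]
  have hββ : star β * β = ((‖β‖ ^ 2 : ℝ) : ℂ) := by
    rw [Complex.star_def, ← Complex.normSq_eq_conj_mul_self, Complex.normSq_eq_norm_sq]
  constructor
  · rw [mulVec_add, mulVec_smul, mulVec_smul, hψ, hφ, star_add, star_smul, star_smul,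
      add_dotProduct, smul_dotProduct, smul_dotProduct, dotProduct_add, dotProduct_add]
    simp only [dotProduct_smul, smul_eq_mul, horth, horth', mul_zero, add_zero, zero_add]
    rw [hψψ, hφφ]
    have e1 : star α * (α * ((a : ℂ) * ((star ψ ⬝ᵥ ψ).re : ℂ))) =
        ((a * (‖α‖ ^ 2 * (star ψ ⬝ᵥ ψ).re) : ℝ) : ℂ) := by
      rw [← mul_assoc, hαα, Complex.ofReal_mul, Complex.ofReal_mul]; ring
    have e2 : star β * (β * ((b : ℂ) * ((star φ ⬝ᵥ φ).re : ℂ))) =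
        ((b * (‖β‖ ^ 2 * (star φ ⬝ᵥ φ).re) : ℝ) : ℂ) := by
      rw [← mul_assoc, hββ, Complex.ofReal_mul, Complex.ofReal_mul]; ring
    rw [e1, e2, ← Complex.ofReal_add, Complex.ofReal_re]
    simp only [Complex.ofReal_re]
  · rw [star_add, star_smul, star_smul, add_dotProduct, smul_dotProduct, smul_dotProduct,
      dotProduct_add, dotProduct_add]
    simp only [dotProduct_smul, smul_eq_mul, horth, horth', mul_zero, add_zero, zero_add]
    rw [hψψ, hφφ, ← mul_assoc, ← mul_assoc, hαα, hββ, ← Complex.ofReal_mul, ← Complex.ofReal_mul,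
      ← Complex.ofReal_add, Complex.ofReal_re]
    simp only [Complex.ofReal_re]

/-! ### The variational principle on an invariant subspace -/

/-- **Variational principle on an invariant subspace.** Let `A` be Hermitian and `W` a subspace
with `A W ⊆ W`. If `E ‖v‖² ≤ Re ⟨v, A v⟩` on `W` and `w ∈ W` attains the bound, then `A w = E w`.
(Expand `0 ≤ Re ⟨w + t z, (A - E)(w + t z)⟩` with `z = (A - E) w ∈ W`.) Lieb–Wu, Physica A 321
(2003) 1, §2 ("by the variational principle"); Tasaki (2020) §2.1. [cite: LiebWuPhysicaA2003, §2] -/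
theorem mulVec_eq_smul_of_forall_le_on {A : Matrix ι ι ℂ} (hA : Aᴴ = A) (W : Submodule ℂ (ι → ℂ))
    (hW : ∀ v ∈ W, A *ᵥ v ∈ W) {E : ℝ}
    (hE : ∀ v ∈ W, E * (star v ⬝ᵥ v).re ≤ (star v ⬝ᵥ A *ᵥ v).re) {w : ι → ℂ} (hwW : w ∈ W)
    (hw : (star w ⬝ᵥ A *ᵥ w).re ≤ E * (star w ⬝ᵥ w).re) : A *ᵥ w = (E : ℂ) • w := by
  set T : (ι → ℂ) → (ι → ℂ) := fun v => A *ᵥ v - (E : ℂ) • v with hT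
  have hTW : ∀ v ∈ W, T v ∈ W := fun v hv => W.sub_mem (hW v hv) (W.smul_mem _ hv)
  have hre : ∀ v v' : ι → ℂ, (star v ⬝ᵥ T v').re =
      (star v ⬝ᵥ A *ᵥ v').re - E * (star v ⬝ᵥ v').re := by
    intro v v'
    simp only [hT, dotProduct_sub, dotProduct_smul, smul_eq_mul, Complex.sub_re,
      Complex.re_ofReal_mul]
  have hTpos : ∀ v ∈ W, 0 ≤ (star v ⬝ᵥ T v).re := fun v hv => by rw [hre]; linarith [hE v hv]
  have hTw : (star w ⬝ᵥ T w).re ≤ 0 := by rw [hre]; linarith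
  have hTsa : ∀ v v' : ι → ℂ, star v ⬝ᵥ T v' = star (star v' ⬝ᵥ T v) := by
    intro v v'
    simp only [hT, dotProduct_sub, dotProduct_smul, smul_eq_mul, star_sub, star_mul',
      Complex.star_def, Complex.conj_ofReal]
    rw [star_dotProduct_mulVec_comm hA v v', star_dotProduct v v']
    rfl
  have hTadd : ∀ v v', T (v + v') = T v + T v' := by
    intro v v'
    simp only [hT, mulVec_add, smul_add]
    abel
  have hTsmul : ∀ (c : ℂ) (v), T (c • v) = c • T v := by
    intro c v
    simp only [hT, mulVec_smul, smul_sub, smul_comm c (E : ℂ) v]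
  set z := T w with hz
  have hzW : z ∈ W := hTW w hwW
  have hzz : (star z ⬝ᵥ z).im = 0 := im_star_dotProduct_self z
  have hwTz : (star w ⬝ᵥ T z).re = (star z ⬝ᵥ z).re := by
    rw [hTsa, Complex.star_def, Complex.conj_re]
  have hexp : ∀ t : ℝ, (star (w + (t : ℂ) • z) ⬝ᵥ T (w + (t : ℂ) • z)).re =
      (star w ⬝ᵥ T w).re + 2 * t * (star z ⬝ᵥ z).re + t ^ 2 * (star z ⬝ᵥ T z).re := by
    intro t
    rw [hTadd, hTsmul, star_add, star_smul, add_dotProduct, dotProduct_add, dotProduct_add,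
      smul_dotProduct, smul_dotProduct, dotProduct_smul, dotProduct_smul, ← hz]
    simp only [smul_eq_mul, Complex.star_def, Complex.conj_ofReal, Complex.add_re,
      Complex.re_ofReal_mul, hwTz]
    ring
  set q := (star z ⬝ᵥ z).re with hq
  set c := (star z ⬝ᵥ T z).re with hc
  have hc0 : 0 ≤ c := hTpos z hzW
  have hmem : w + (((-q / (c + 1) : ℝ) : ℂ)) • z ∈ W := W.add_mem hwW (W.smul_mem _ hzW)
  have key := hTpos _ hmem
  rw [hexp] at key
  have hq0 : q = 0 := by
    have hc1 : (0 : ℝ) < c + 1 := by linarith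
    have h1 : (star w ⬝ᵥ T w).re + 2 * (-q / (c + 1)) * q + (-q / (c + 1)) ^ 2 * c =
        (star w ⬝ᵥ T w).re - q ^ 2 * (c + 2) / (c + 1) ^ 2 := by
      field_simp
      ring
    rw [h1] at key
    have h3 : q ^ 2 * (c + 2) / (c + 1) ^ 2 ≤ 0 := by linarith
    rw [div_le_iff₀ (by positivity), zero_mul] at h3
    nlinarith [sq_nonneg q]
  have hz0 : z = 0 := by
    have h : star z ⬝ᵥ z = 0 := Complex.ext (by simpa [hq] using hq0) (by simpa using hzz)
    exact dotProduct_star_self_eq_zero.1 h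
  exact sub_eq_zero.1 hz0

/-! ### The gap above a simple lowest eigenvalue -/

/-- The unit sphere `{w ∈ W | ⟨w, w⟩ = 1}` of a subspace of `ι → ℂ` is compact. [folklore] -/
theorem isCompact_unitSphere_inter (W : Submodule ℂ (ι → ℂ)) :
    IsCompact {w : ι → ℂ | w ∈ W ∧ star w ⬝ᵥ w = 1} := by
  have hcont : Continuous fun w : ι → ℂ => star w ⬝ᵥ w := by
    simp only [dotProduct, Pi.star_apply, Complex.star_def]
    fun_prop
  refine Metric.isCompact_of_isClosed_isBounded ?_ ?_
  · exact (W.closed_of_finiteDimensional).inter (isClosed_eq hcont continuous_const)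
  · refine (Metric.isBounded_iff_subset_closedBall 0).2 ⟨1, fun w hw => ?_⟩
    rw [mem_closedBall_zero_iff, pi_norm_le_iff_of_nonneg zero_le_one]
    intro i
    have h := norm_apply_sq_le w i
    rw [hw.2, Complex.one_re] at h
    nlinarith [norm_nonneg (w i)]

/-- Continuity of the energy `w ↦ Re ⟨w, A w⟩`. [folklore] -/
theorem continuous_energy (A : Matrix ι ι ℂ) : Continuous fun w : ι → ℂ => (star w ⬝ᵥ A *ᵥ w).re := by
  have : Continuous fun w : ι → ℂ => star w ⬝ᵥ A *ᵥ w := by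
    simp only [dotProduct, Pi.star_apply, mulVec, Complex.star_def]
    fun_prop
  exact Complex.continuous_re.comp this

/-- **The gap.** If `A` is Hermitian, preserves `K`, `m ‖v‖² ≤ Re ⟨v, A v⟩` on `K`, and the
ground state `ψ₀ ∈ K` (`A ψ₀ = m ψ₀`, `ψ₀ ≠ 0`) is unique up to scalars, then there is `g > 0`
with `(m + g) ‖w‖² ≤ Re ⟨w, A w⟩` for all `w ∈ K` orthogonal to `ψ₀` ("at which point there
would be a degeneracy – which is impossible according to 1."). [cite: LiebWuPhysicaA2003, §2] -/
theorem exists_gap_of_unique {A : Matrix ι ι ℂ} (hA : Aᴴ = A) (K : Submodule ℂ (ι → ℂ))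
    (hK : ∀ v ∈ K, A *ᵥ v ∈ K) {m : ℝ} (hm : ∀ v ∈ K, m * (star v ⬝ᵥ v).re ≤ (star v ⬝ᵥ A *ᵥ v).re)
    {ψ₀ : ι → ℂ} (hψ₀0 : ψ₀ ≠ 0) (hψ₀ : A *ᵥ ψ₀ = (m : ℂ) • ψ₀)
    (huniq : ∀ ψ ∈ K, A *ᵥ ψ = (m : ℂ) • ψ → ∃ c : ℂ, ψ = c • ψ₀) :
    ∃ g : ℝ, 0 < g ∧
      ∀ w ∈ K, star ψ₀ ⬝ᵥ w = 0 → (m + g) * (star w ⬝ᵥ w).re ≤ (star w ⬝ᵥ A *ᵥ w).re := by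
  classical
  -- the invariant subspace `W = K ∩ ψ₀^⊥`
  let W : Submodule ℂ (ι → ℂ) :=
    { carrier := {w | w ∈ K ∧ star ψ₀ ⬝ᵥ w = 0}
      add_mem' := fun {a b} ha hb =>
        ⟨K.add_mem ha.1 hb.1, by rw [dotProduct_add, ha.2, hb.2, add_zero]⟩
      zero_mem' := ⟨K.zero_mem, dotProduct_zero _⟩
      smul_mem' := fun c {a} ha => ⟨K.smul_mem c ha.1, by rw [dotProduct_smul, ha.2, smul_zero]⟩ }
  have hWmem : ∀ {w}, w ∈ W ↔ w ∈ K ∧ star ψ₀ ⬝ᵥ w = 0 := fun {w} => Iff.rfl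
  have hWinv : ∀ w ∈ W, A *ᵥ w ∈ W := by
    intro w hw
    refine ⟨hK w hw.1, ?_⟩
    rw [star_dotProduct_mulVec_comm hA, hψ₀, dotProduct_smul, smul_eq_mul, star_mul',
      ← star_dotProduct, hw.2, mul_zero]
  -- normalisation into the unit sphere `C` of `W`
  set C : Set (ι → ℂ) := {w | w ∈ W ∧ star w ⬝ᵥ w = 1} with hC
  have hnormal : ∀ w ∈ W, w ≠ 0 → ∃ c : ℝ, 0 < c ∧ c * c * (star w ⬝ᵥ w).re = 1 ∧ (c : ℂ) • w ∈ C := by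
    intro w hw hw0
    obtain ⟨c, hc, hcc, h1⟩ := exists_normalize hw0
    exact ⟨c, hc, hcc, W.smul_mem _ hw, h1⟩
  by_cases hCne : C.Nonempty
  · -- minimise the energy on the unit sphere of `W`
    obtain ⟨w₀, hw₀C, hmin⟩ :=
      (isCompact_unitSphere_inter W).exists_isMinOn hCne (continuous_energy A).continuousOn
    set μ : ℝ := (star w₀ ⬝ᵥ A *ᵥ w₀).re with hμ
    have hμle : ∀ w ∈ W, μ * (star w ⬝ᵥ w).re ≤ (star w ⬝ᵥ A *ᵥ w).re := by
      intro w hw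
      by_cases hw0 : w = 0
      · simp [hw0]
      obtain ⟨c, hc, hcc, hcC⟩ := hnormal w hw hw0
      have h1 : μ ≤ (star ((c : ℂ) • w) ⬝ᵥ A *ᵥ ((c : ℂ) • w)).re := hmin hcC
      rw [mulVec_smul, star_real_smul_dotProduct_real_smul, Complex.re_ofReal_mul] at h1
      have hpos := re_star_dotProduct_self_pos hw0
      calc μ * (star w ⬝ᵥ w).re ≤ c * c * (star w ⬝ᵥ A *ᵥ w).re * (star w ⬝ᵥ w).re :=
            mul_le_mul_of_nonneg_right h1 hpos.le
        _ = (star w ⬝ᵥ A *ᵥ w).re * (c * c * (star w ⬝ᵥ w).re) := by ring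
        _ = (star w ⬝ᵥ A *ᵥ w).re := by rw [hcc, mul_one]
    -- the minimiser is an eigenvector, with eigenvalue `μ > m`
    have hw₀W : w₀ ∈ W := hw₀C.1
    have heig : A *ᵥ w₀ = (μ : ℂ) • w₀ :=
      mulVec_eq_smul_of_forall_le_on hA W hWinv hμle hw₀W (by rw [hw₀C.2, Complex.one_re, mul_one])
    have hw₀0 : w₀ ≠ 0 := by
      intro h
      have := hw₀C.2
      rw [h, dotProduct_zero] at this
      exact zero_ne_one this
    have hmμ : m ≤ μ := by
      have := hm w₀ hw₀W.1
      rwa [hw₀C.2, Complex.one_re, mul_one, ← hμ] at this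
    have hne : m ≠ μ := by
      intro hmμ'
      rw [← hmμ'] at heig
      obtain ⟨c, hc⟩ := huniq w₀ hw₀W.1 heig
      have h0 : star ψ₀ ⬝ᵥ w₀ = 0 := hw₀W.2
      rw [hc, dotProduct_smul, smul_eq_mul] at h0
      rcases mul_eq_zero.1 h0 with h | h
      · exact hw₀0 (by rw [hc, h, zero_smul])
      · exact hψ₀0 (dotProduct_star_self_eq_zero.1 h)
    refine ⟨μ - m, sub_pos.2 (lt_of_le_of_ne hmμ hne), fun w hwK hw => ?_⟩
    rw [add_sub_cancel]
    exact hμle w ⟨hwK, hw⟩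
  · refine ⟨1, one_pos, fun w hwK hw => ?_⟩
    by_cases hw0 : w = 0
    · simp [hw0]
    · obtain ⟨c, -, -, hcC⟩ := hnormal w ⟨hwK, hw⟩ hw0
      exact absurd ⟨_, hcC⟩ hCne

end EigenvalueContinuation

open EigenvalueContinuation

variable {ι : Type*} [Fintype ι]

/-- **Continuation of a simple lowest eigenvalue along a continuous eigenvalue curve** (Lieb–Wu's
use of the uniqueness of the ground state, Physica A 321 (2003) 1, §2: "suppose we have a
`U`-dependent solution ... with an energy `E(U)` such that (a) `E` is the known ground state
energy [at one `U`] and (b) `E(U)` is continuous on the interval. Then `E(U)` is necessarily the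
ground state energy in that interval", made precise). Let `A u` (`u ∈ S`, `S ⊆ ℝ` preconnected)
be Hermitian matrices preserving the subspace `K`, with energies on `K` `d`-Lipschitz in `u`; let
`m u` be a lower bound of the energy on `K` attained at a nonzero eigenvector `ψ ∈ K`
(`A u ψ = m u ψ`), unique up to scalars. If `E` is continuous on `S`, every `E u` is an
eigenvalue of `A u` on a nonzero vector of `K`, and `E u₀ = m u₀` for one `u₀ ∈ S`, then
`E u = m u` for all `u ∈ S`. [cite: LiebWuPhysicaA2003, §2] -/
theorem eigenvalue_eq_sectorMin_of_continuousOn (K : Submodule ℂ (ι → ℂ)) (A : ℝ → Matrix ι ι ℂ)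
    (m E : ℝ → ℝ) (S : Set ℝ) {d : ℝ} (hd : 0 ≤ d) (hherm : ∀ u ∈ S, (A u)ᴴ = A u)
    (hinv : ∀ u ∈ S, ∀ v ∈ K, A u *ᵥ v ∈ K)
    (hlip : ∀ u ∈ S, ∀ u' ∈ S, ∀ v ∈ K,
      |(star v ⬝ᵥ A u *ᵥ v).re - (star v ⬝ᵥ A u' *ᵥ v).re| ≤ d * |u - u'| * (star v ⬝ᵥ v).re)
    (hmle : ∀ u ∈ S, ∀ v ∈ K, m u * (star v ⬝ᵥ v).re ≤ (star v ⬝ᵥ A u *ᵥ v).re)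
    (hgs : ∀ u ∈ S, ∃ ψ ∈ K, ψ ≠ 0 ∧ A u *ᵥ ψ = (m u : ℂ) • ψ)
    (huniq : ∀ u ∈ S, ∀ ψ₁ ∈ K, ∀ ψ₂ ∈ K, ψ₁ ≠ 0 → A u *ᵥ ψ₁ = (m u : ℂ) • ψ₁ →
      A u *ᵥ ψ₂ = (m u : ℂ) • ψ₂ → ∃ c : ℂ, ψ₂ = c • ψ₁)
    (hS : IsPreconnected S) (hE : ContinuousOn E S)
    (hev : ∀ u ∈ S, ∃ φ ∈ K, φ ≠ 0 ∧ A u *ᵥ φ = (E u : ℂ) • φ)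
    {u₀ : ℝ} (hu₀ : u₀ ∈ S) (h0 : E u₀ = m u₀) : ∀ u ∈ S, E u = m u := by
  classical
  -- Step A: `m` is `d`-Lipschitz on `S`
  have hmlip : ∀ u ∈ S, ∀ u' ∈ S, m u ≤ m u' + d * |u - u'| := by
    intro u hu u' hu'
    obtain ⟨ψ, hψK, hψ0, hψ⟩ := hgs u' hu'
    have hpos := re_star_dotProduct_self_pos hψ0
    have h1 := hmle u hu ψ hψK
    have h2 := hlip u hu u' hu' ψ hψK
    rw [re_star_dotProduct_mulVec_of_eigen hψ] at h2
    have h3 : (star ψ ⬝ᵥ A u *ᵥ ψ).re ≤ m u' * (star ψ ⬝ᵥ ψ).re + d * |u - u'| * (star ψ ⬝ᵥ ψ).re := by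
      have := (abs_le.1 h2).2; linarith
    have h4 : m u * (star ψ ⬝ᵥ ψ).re ≤ (m u' + d * |u - u'|) * (star ψ ⬝ᵥ ψ).re := by linarith
    exact le_of_mul_le_mul_right h4 hpos
  have hmabs : ∀ u ∈ S, ∀ u' ∈ S, |m u - m u'| ≤ d * |u - u'| := by
    intro u hu u' hu'
    rw [abs_le]
    have h1 := hmlip u hu u' hu'
    have h2 := hmlip u' hu' u hu
    rw [abs_sub_comm] at h2
    constructor <;> linarith
  -- Step B: local constancy of the coincidence near a coincidence point
  have hopen : ∀ us ∈ S, E us = m us → ∃ δ > 0, ∀ u ∈ S, |u - us| < δ → E u = m u := by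
    intro us hus hEus
    obtain ⟨ψ₀, hψ₀K, hψ₀0, hψ₀⟩ := hgs us hus
    obtain ⟨g, hg, hgap⟩ := exists_gap_of_unique (hherm us hus) K (hinv us hus) (hmle us hus) hψ₀0 hψ₀
      (fun ψ hψK hψ => huniq us hus ψ₀ hψ₀K ψ hψK hψ₀0 hψ₀ hψ)
    -- `δ₁` with `d δ₁ ≤ g / 4`, `δ₂` from the continuity of `E`
    obtain ⟨δ₁, hδ₁, hdδ₁⟩ : ∃ δ₁ > 0, d * δ₁ ≤ g / 4 := by
      rcases hd.lt_or_eq with hd' | hd'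
      · exact ⟨g / (4 * d), by positivity, by field_simp; rfl⟩
      · exact ⟨1, one_pos, by rw [← hd']; linarith⟩
    obtain ⟨δ₂, hδ₂, hEδ₂⟩ : ∃ δ₂ > 0, ∀ u ∈ S, |u - us| < δ₂ → |E u - E us| < g / 4 := by
      have h := (Metric.continuousOn_iff.1 hE) us hus (g / 4) (by positivity)
      obtain ⟨δ₂, hδ₂, h⟩ := h
      exact ⟨δ₂, hδ₂, fun u hu hd2 => by
        have := h u hu (by rwa [Real.dist_eq]); rwa [Real.dist_eq] at this⟩
    refine ⟨min δ₁ δ₂, lt_min hδ₁ hδ₂, fun u hu hdist => ?_⟩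
    have hd1 : |u - us| < δ₁ := lt_of_lt_of_le hdist (min_le_left _ _)
    have hd2 : |u - us| < δ₂ := lt_of_lt_of_le hdist (min_le_right _ _)
    by_contra hne
    obtain ⟨φ, hφK, hφ0, hφ⟩ := hev u hu
    obtain ⟨ψ₁, hψ₁K, hψ₁0, hψ₁⟩ := hgs u hu
    have hne' : m u ≠ E u := fun h => hne h.symm
    have horth : star ψ₁ ⬝ᵥ φ = 0 := star_dotProduct_eq_zero_of_eigen (hherm u hu) hne' hψ₁ hφ
    -- a nonzero vector of `span {ψ₁, φ} ∩ ψ₀^⊥`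
    obtain ⟨α, β, hαβ, hw0⟩ : ∃ α β : ℂ, star ψ₀ ⬝ᵥ (α • ψ₁ + β • φ) = 0 ∧ α • ψ₁ + β • φ ≠ 0 := by
      by_cases ha : star ψ₀ ⬝ᵥ φ = 0
      · refine ⟨0, 1, by simpa using ha, by simpa using hφ0⟩
      · refine ⟨star ψ₀ ⬝ᵥ φ, -(star ψ₀ ⬝ᵥ ψ₁), ?_, ?_⟩
        · rw [dotProduct_add, dotProduct_smul, dotProduct_smul, smul_eq_mul, smul_eq_mul]; ring
        · intro h0
          have h1 : star ψ₁ ⬝ᵥ ((star ψ₀ ⬝ᵥ φ) • ψ₁ + (-(star ψ₀ ⬝ᵥ ψ₁)) • φ) = 0 := by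
            rw [h0, dotProduct_zero]
          rw [dotProduct_add, dotProduct_smul, dotProduct_smul, horth, smul_zero, add_zero,
            smul_eq_mul] at h1
          rcases mul_eq_zero.1 h1 with h | h
          · exact ha h
          · exact hψ₁0 (dotProduct_star_self_eq_zero.1 h)
    set w := α • ψ₁ + β • φ with hw
    have hwK : w ∈ K := K.add_mem (K.smul_mem α hψ₁K) (K.smul_mem β hφK)
    have hwpos := re_star_dotProduct_self_pos hw0
    obtain ⟨hEw, hNw⟩ := energy_pair hψ₁ hφ horth α β
    -- upper bound on the energy of `w` at `u`
    have hmu : m u ≤ m us + g / 4 := by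
      have := hmabs u hu us hus
      have h2 : d * |u - us| ≤ d * δ₁ := mul_le_mul_of_nonneg_left hd1.le hd
      rw [abs_le] at this
      linarith
    have hEu : E u ≤ m us + g / 4 := by
      have := hEδ₂ u hu hd2
      rw [abs_lt] at this
      linarith
    have hupper : (star w ⬝ᵥ A u *ᵥ w).re ≤ (m us + g / 4) * (star w ⬝ᵥ w).re := by
      rw [hw, hEw, hNw, mul_add]
      have h1 : 0 ≤ ‖α‖ ^ 2 * (star ψ₁ ⬝ᵥ ψ₁).re :=
        mul_nonneg (by positivity) (re_star_dotProduct_self_nonneg _)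
      have h2 : 0 ≤ ‖β‖ ^ 2 * (star φ ⬝ᵥ φ).re :=
        mul_nonneg (by positivity) (re_star_dotProduct_self_nonneg _)
      nlinarith [mul_le_mul_of_nonneg_right hmu h1, mul_le_mul_of_nonneg_right hEu h2]
    -- lower bound from the gap at `us`
    have hlower : (m us + g - g / 4) * (star w ⬝ᵥ w).re ≤ (star w ⬝ᵥ A u *ᵥ w).re := by
      have h1 := hgap w hwK hαβ
      have h2 := hlip u hu us hus w hwK
      have h3 : d * |u - us| * (star w ⬝ᵥ w).re ≤ g / 4 * (star w ⬝ᵥ w).re := by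
        refine mul_le_mul_of_nonneg_right ?_ hwpos.le
        exact (mul_le_mul_of_nonneg_left hd1.le hd).trans hdδ₁
      rw [abs_le] at h2
      nlinarith
    nlinarith
  -- Step C: preconnectedness
  choose! δ hδ hδE using hopen
  have hcontEm : ContinuousOn (fun u => E u - m u) S := by
    refine hE.sub ?_
    rw [Metric.continuousOn_iff]
    intro u hu ε hε
    rcases hd.lt_or_eq with hd' | hd'
    · refine ⟨ε / d, by positivity, fun u' hu' hdist => ?_⟩
      rw [Real.dist_eq] at hdist ⊢
      calc |m u' - m u| ≤ d * |u' - u| := hmabs u' hu' u hu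
        _ < d * (ε / d) := mul_lt_mul_of_pos_left hdist hd'
        _ = ε := mul_div_cancel₀ ε hd'.ne'
    · refine ⟨1, one_pos, fun u' hu' _ => ?_⟩
      rw [Real.dist_eq]
      have := hmabs u' hu' u hu
      rw [← hd', zero_mul] at this
      have h0 : m u' - m u = 0 := abs_nonpos_iff.1 this
      rw [h0, abs_zero]; exact hε
  -- the two relatively open pieces
  set O₁ : Set ℝ := ⋃ us ∈ {us | us ∈ S ∧ E us = m us}, Metric.ball us (δ us) with hO₁
  obtain ⟨δ', hδ', hδ'E⟩ : ∃ δ' : ℝ → ℝ, (∀ u ∈ S, E u ≠ m u → 0 < δ' u) ∧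
      ∀ u ∈ S, E u ≠ m u → ∀ u' ∈ S, dist u' u < δ' u → E u' ≠ m u' := by
    have h : ∀ u ∈ S, E u ≠ m u → ∃ r > 0, ∀ u' ∈ S, dist u' u < r → E u' ≠ m u' := by
      intro u hu hne
      have hpos : 0 < |E u - m u| := abs_pos.2 (sub_ne_zero.2 hne)
      obtain ⟨r, hr, h⟩ := (Metric.continuousOn_iff.1 hcontEm) u hu _ hpos
      refine ⟨r, hr, fun u' hu' hdist heq => ?_⟩
      have := h u' hu' hdist
      rw [Real.dist_eq, heq, sub_self, zero_sub, abs_neg] at this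
      exact lt_irrefl _ this
    choose! δ' hδ' hδ'E using h
    exact ⟨δ', hδ', hδ'E⟩
  set O₂ : Set ℝ := ⋃ us ∈ {us | us ∈ S ∧ E us ≠ m us}, Metric.ball us (δ' us) with hO₂
  have hO₁open : IsOpen O₁ := isOpen_biUnion fun _ _ => Metric.isOpen_ball
  have hO₂open : IsOpen O₂ := isOpen_biUnion fun _ _ => Metric.isOpen_ball
  have hO₁S : ∀ u ∈ S, u ∈ O₁ → E u = m u := by
    intro u hu hu1
    rw [hO₁] at hu1
    simp only [mem_iUnion, Metric.mem_ball, exists_prop] at hu1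
    obtain ⟨us, ⟨hus, hEus⟩, hdist⟩ := hu1
    exact hδE us hus hEus u hu (by rwa [Real.dist_eq] at hdist)
  have hO₂S : ∀ u ∈ S, u ∈ O₂ → E u ≠ m u := by
    intro u hu hu2
    rw [hO₂] at hu2
    simp only [mem_iUnion, Metric.mem_ball, exists_prop] at hu2
    obtain ⟨us, ⟨hus, hEus⟩, hdist⟩ := hu2
    exact hδ'E us hus hEus u hu hdist
  have hcover : S ⊆ O₁ ∪ O₂ := by
    intro u hu
    by_cases h : E u = m u
    · left
      rw [hO₁]
      simp only [mem_iUnion, Metric.mem_ball, exists_prop]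
      exact ⟨u, ⟨hu, h⟩, by rw [dist_self]; exact hδ u hu h⟩
    · right
      rw [hO₂]
      simp only [mem_iUnion, Metric.mem_ball, exists_prop]
      exact ⟨u, ⟨hu, h⟩, by rw [dist_self]; exact hδ' u hu h⟩
  have hne₁ : (S ∩ O₁).Nonempty := ⟨u₀, hu₀, hcover hu₀ |>.resolve_right (fun h2 => hO₂S u₀ hu₀ h2 h0)⟩
  intro u hu
  by_contra hne
  have hne₂ : (S ∩ O₂).Nonempty := ⟨u, hu, hcover hu |>.resolve_left (fun h1 => hne (hO₁S u hu h1))⟩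
  obtain ⟨v, hvS, hv1, hv2⟩ := hS O₁ O₂ hO₁open hO₂open hcover hne₁ hne₂
  exact hO₂S v hvS hv2 (hO₁S v hvS hv1)

end Literature.MathematicalPhysics.QuantumLattice
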